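import Literature.NumberTheory.EllipticCurves.Wuthrich2014.ReducibleDivisibilityCyclotomicPrimeHalf
import Literature.NumberTheory.EllipticCurves.Wuthrich2014.ReducibleDivisibilityCyclotomicPrimeComponent
import HarnessLib

/-!
# Wuthrich 2014 Thm. 16, component `(p−1)/2`, GOOD ORDINARY inline-datum form (A125)
# `charIdeal_dvd_padicLFunctionBranch_component` — DERIVED from the semistable component reading
# `thm16_halfEigenCharIdeal_dvd_cyclotomicPrime` (NO named fact in this file; kernel consistency check)

Source: C. Wuthrich, *On the integrality of modular symbols and Kato's Euler system for elliptic
curves*, Doc. Math. 19 (2014) 381–402 [Wuthrich2014], Theorem 16 (p. 397) with §3 (p. 390, "we split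
`M` up into the eigenspaces `M = ⊕_{i=0}^{p−2} M_i`"), §5 (p. 397), Cor. 18 (p. 398); see the two
module docstrings for the full reading.

The cell `b2b-bsdres` holds TWO transcriptions of the SAME printed sentence on the component
`m = (p−1)/2` at a good ordinary `p`: additive-p2's `charIdeal_dvd_padicLFunctionBranch_component`
(A125; the eigen-Selmer datum INLINED as an `AddSubgroup S` with a membership characterisation, a
module `X` and a bijection `toDual` with its `T`- and `C`-identities) and additive-p1's
`thm16_halfEigenCharIdeal_dvd_cyclotomicPrime` (the SEMISTABLE reading in the Literature structure
`WeierstrassCurve.EigenSelmerDualData`, whose first disjunct is the good ordinary case). Literature-seat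
ruling C169 (2026-08-20) asked for the kernel derivation of the former from the latter, so that the
referee may retire the special case by migrating its consumers. THIS FILE is that derivation: the
inline subgroup `S` EQUALS `eigenSelmerGroupOver V p H (ker κ) χ_K` (`AddSubgroup.ext` on the
membership characterisation; `(if g ∈ galRange K then 1 else −1) • t = if … then t else −t`), after
`subst` the inline data ARE an `EigenSelmerDualData`, and the general fact's good-ordinary disjunct is
the claim. ONE theorem, no `def`, no new assertion (debt 0).
-/

set_option autoImplicit false

noncomputable section

open scoped Classical MatrixGroups ModularForm

open CongruenceSubgroup WeierstrassCurve Literature.NumberTheory.EllipticCurves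
  Literature.NumberTheory.EllipticCurves.ModularForms
  Literature.NumberTheory.GaloisRepresentations

namespace Literature.NumberTheory.EllipticCurves.Wuthrich2014

/-- **A125 from the semistable component reading.** Wuthrich 2014 Thm. 16 (Doc. Math. 19 (2014),
p. 397: "Suppose that `E` has semi-stable reduction at `p` and that `E[p]` is reducible as a
`G_ℚ`-module. Then `char_Λ X(E)` divides the ideal generated by `L_p(E)`"), component `m = (p−1)/2`
(§3 p. 390), good ordinary `p`, in additive-p2's inline-datum form
`charIdeal_dvd_padicLFunctionBranch_component`, follows from
`thm16_halfEigenCharIdeal_dvd_cyclotomicPrime`: the inline eigen-subgroup `S` is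
`eigenSelmerGroupOver V p (ker κ ⊓ galRange K ⊓ galRange F) (ker κ) χ_K` by extensionality, the inline
`(X, toDual, …)` is then an `EigenSelmerDualData`, and the good-ordinary disjunct of the general fact
(branch `padicLFunction[Minus]Branch f (unitRoot V p) (p/2)` by parity) is the conclusion. Kernel
consistency check between two transcriptions of the same sentence; no new assertion.
[cite: Wuthrich2014, Thm. 16 and §5 (p. 397), §3 (p. 390), Cor. 18 (p. 398)] -/
theorem charIdeal_dvd_padicLFunctionBranch_component_of_half
    (h : thm16_halfEigenCharIdeal_dvd_cyclotomicPrime) :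
    charIdeal_dvd_padicLFunctionBranch_component := by
  intro p _ V _ _ K _ _ _ F _ _ _ _ κ γ N _ f S hSγ X _ _ toDual hp2 h2 hθ hord hred hκ hγ hcyc hγK hγF
    hf hS hbij hT hC ϖ hϖ
  -- the inline subgroup is the Literature eigen-Selmer group
  obtain rfl : S = V.eigenSelmerGroupOver p
      (κ.kerSubgroup ⊓ galRange (K := ℚ) K ⊓ galRange (K := ℚ) F) κ.kerSubgroup
      (fun g ↦ if g ∈ galRange (K := ℚ) K then 1 else -1) := by
    ext t
    rw [hS t, mem_eigenSelmerGroupOver_iff]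
    refine and_congr_right fun _ ↦ ⟨fun H g ↦ ?_, fun H g hg ↦ ?_⟩
    · rw [H g g.2]
      split_ifs <;> simp
    · rw [H ⟨g, hg⟩]
      simp only
      split_ifs <;> simp
  -- the inline data are an eigen dual datum
  let D : V.EigenSelmerDualData p (κ.kerSubgroup ⊓ galRange (K := ℚ) K ⊓ galRange (K := ℚ) F)
      κ.kerSubgroup (fun g ↦ if g ∈ galRange (K := ℚ) K then 1 else -1) γ :=
    { X := X, conj_mem := hSγ, toDual := toDual, bijective := hbij, toDual_T_smul := hT,
      toDual_C_smul := hC }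
  exact h p V K F _ hp2 h2 hθ (Or.inl ⟨hord, rfl⟩) hred hκ hγ hcyc hγK hγF hf D ϖ hϖ

end Literature.NumberTheory.EllipticCurves.Wuthrich2014

end
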